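import Summits.RiemannHypothesis.RiemannHypothesis.Theorems.WeilFormatCCinfDoorPoly
import Summits.RiemannHypothesis.RiemannHypothesis.Theorems.WeilFormatCDeflatedFarParseval
import HarnessLib

/-!
# Format C, design C∞ (E3, analytic side): the MARGIN of the front door as ONE quadratic form on `Fin (B+1) ⊕ Fin r`

Route context: Fourier–Galerkin / Schur-complement certificates of Weil positivity on a window ("format C", C∞ door;
cell memo `run/shared/lean/pub/rh-explicit/rh-explicit-weil-10/KERNEL-LEVER.md` §22; supporting stmt-RiemannHypothesis-0098;
seat rh-explicit-weil-10).  The margin hypothesis of `weilPositivityOn_of_cinf_poly` (in the resolved form of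
`hS_even/odd_of_entries`) reads, for `z = (x, β)`,

  `δ(‖x‖² + ‖β‖²) ≤ xᵀMx + 2xᵀCβ + βᵀPβ − Uq(x,β) + 2Σ_j (Λ₁x + Λ₂β)_j (β − Eβ)_j`

with the kernel block `M`, the resolved cross entries `C`, the resolved profile entries `P`, the dominating form `Uq`
and the resolved far Parseval table `E`.  When `Uq` is itself a quadratic form `zᵀUz` this is ONE symmetric quadratic
form: `zᵀSz` with `S = [[M, C + L₁], [(C + L₁)ᵀ, P + L₂]] − U`, `L₁(i,j) = Λ₁(j,i) − Σ_{j₀} Λ₁(j₀,i)E(j₀,j)`,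
`L₂(j,j') = Λ₂(j',j) + Λ₂(j,j') − Σ_{j₀} Λ₂(j₀,j)E(j₀,j') − Σ_{j₀} Λ₂(j₀,j')E(j₀,j)` — so the rung's margin certificate is a
single kernel PSD check (`PsdDyadic.psd_of_checkPsdMid`) of the boxed matrix `S − δ·1` on `Fin (B+1+r)`.

* `margin_eq_quadForm` — the algebra above (generic real matrices);
* `quadForm_margin_of_fin` — the PSD-check shape `0 ≤ Σ_p Σ_{p'} α_p α_{p'} (S(e⁻¹p, e⁻¹p') − δ[p = p'])` on
  `Fin (B + r)` (`e = finSumFinEquiv`) gives `δ Σ_k z_k² ≤ Σ_k Σ_{k'} z_k z_{k'} S(k,k')` on `Fin B ⊕ Fin r`;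
* `hS_even_of_quadForm` / `hS_odd_of_quadForm` — LITERALLY the `hS` hypothesis of `hS_even_of_entries` /
  `hS_odd_of_entries` (resolved entries) with `Uq(x,β) := Σ_k Σ_{k'} z_k z_{k'} U(k,k')`, from the margin of `S`.

Pure finite-dimensional algebra; standard axioms; no definitions; no RH claim.
-/

set_option autoImplicit false
-- `Summit.RiemannHypothesis.RiemannHypothesis.…` is the layout-mandated namespace (summit = problem name).
set_option linter.dupNamespace false

noncomputable section

open Complex Filter Set MeasureTheory Finset
open scoped Real Topology ComplexConjugate

namespace Summit.RiemannHypothesis.RiemannHypothesis.Theorems.WeilFormatC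

open Literature.NumberTheory.LFunctions Literature.NumberTheory.LFunctions.Yoshida1992

variable {a : ℝ}

/-! ## Generic algebra: the margin as one quadratic form -/

/-- `Σ_j (Σ_i a(j,i)x_i)·b_j = Σ_i Σ_j x_i b_j a(j,i)`. -/
theorem sum_linearForm_mul_eq {ι κ : Type*} [Fintype ι] [Fintype κ] (A : κ → ι → ℝ) (x : ι → ℝ) (b : κ → ℝ) :
    ∑ j, (∑ i, A j i * x i) * b j = ∑ i, ∑ j, x i * b j * A j i := by
  rw [Finset.sum_comm]
  refine Finset.sum_congr rfl fun j _ ↦ ?_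
  rw [Finset.sum_mul]
  exact Finset.sum_congr rfl fun i _ ↦ by ring

/-- `Σ_j (Σ_i a(j,i)x_i)·(Σ_{j'} E(j,j')b_{j'}) = Σ_i Σ_{j'} x_i b_{j'} Σ_j a(j,i)E(j,j')`. -/
theorem sum_linearForm_mul_linearForm_eq {ι κ : Type*} [Fintype ι] [Fintype κ] (A : κ → ι → ℝ)
    (E : κ → κ → ℝ) (x : ι → ℝ) (b : κ → ℝ) :
    ∑ j, (∑ i, A j i * x i) * (∑ j', E j j' * b j') = ∑ i, ∑ j', x i * b j' * ∑ j, A j i * E j j' := by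
  have h1 : ∀ j, (∑ i, A j i * x i) * (∑ j', E j j' * b j') = ∑ i, ∑ j', x i * b j' * (A j i * E j j') := by
    intro j
    rw [Finset.sum_mul_sum]
    refine Finset.sum_congr rfl fun i _ ↦ Finset.sum_congr rfl fun j' _ ↦ by ring
  simp_rw [h1]
  rw [Finset.sum_comm]
  refine Finset.sum_congr rfl fun i _ ↦ ?_
  rw [Finset.sum_comm]
  refine Finset.sum_congr rfl fun j' _ ↦ ?_
  rw [Finset.mul_sum]

/-- **The margin as ONE quadratic form.**  For `z = (x, β)` on `Fin B ⊕ Fin r`: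
`xᵀMx + 2xᵀCβ + βᵀPβ − zᵀUz + 2Σ_j(Λ₁x + Λ₂β)_j(β − Eβ)_j = zᵀSz` with
`S = [[M, C + L₁], [(C + L₁)ᵀ, P + L₂]] − U`, `L₁(i,j) = Λ₁(j,i) − Σ_{j₀}Λ₁(j₀,i)E(j₀,j)`,
`L₂(j,j') = Λ₂(j',j) + Λ₂(j,j') − Σ_{j₀}Λ₂(j₀,j)E(j₀,j') − Σ_{j₀}Λ₂(j₀,j')E(j₀,j)`. -/
theorem margin_eq_quadForm {B r : ℕ} (M : Fin B → Fin B → ℝ) (C : Fin B → Fin r → ℝ)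
    (P : Fin r → Fin r → ℝ) (U : Fin B ⊕ Fin r → Fin B ⊕ Fin r → ℝ)
    (Λ1 : Fin r → Fin B → ℝ) (Λ2 : Fin r → Fin r → ℝ) (E : Fin r → Fin r → ℝ)
    (x : Fin B → ℝ) (β : Fin r → ℝ) :
    ((∑ i, ∑ i', x i * x i' * M i i') + 2 * (∑ i, ∑ j, x i * β j * C i j) + (∑ j, ∑ j', β j * β j' * P j j'))
        - (∑ k, ∑ k', Sum.elim x β k * Sum.elim x β k' * U k k')
        + 2 * ∑ j, (∑ i, Λ1 j i * x i + ∑ j', Λ2 j j' * β j') * (β j - ∑ j', E j j' * β j')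
      = ∑ k, ∑ k', Sum.elim x β k * Sum.elim x β k' *
          (Sum.elim
              (fun i : Fin B ↦ Sum.elim (fun i' : Fin B ↦ M i i')
                (fun j : Fin r ↦ C i j + (Λ1 j i - ∑ j₀, Λ1 j₀ i * E j₀ j)) k')
              (fun j : Fin r ↦ Sum.elim (fun i' : Fin B ↦ C i' j + (Λ1 j i' - ∑ j₀, Λ1 j₀ i' * E j₀ j))
                (fun j' : Fin r ↦ P j j' + (Λ2 j' j + Λ2 j j' - ∑ j₀, Λ2 j₀ j * E j₀ j' - ∑ j₀, Λ2 j₀ j' * E j₀ j)) k')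
              k
            - U k k') := by
  -- the free-map term, expanded into the four elementary double sums
  have hT0 : ∑ j, (∑ i, Λ1 j i * x i + ∑ j', Λ2 j j' * β j') * (β j - ∑ j', E j j' * β j')
      = ∑ j, (∑ i, Λ1 j i * x i) * β j - ∑ j, (∑ i, Λ1 j i * x i) * (∑ j', E j j' * β j')
        + ∑ j, (∑ j', Λ2 j j' * β j') * β j - ∑ j, (∑ j', Λ2 j j' * β j') * (∑ j', E j j' * β j') := by
    simp only [← Finset.sum_sub_distrib, ← Finset.sum_add_distrib]
    exact Finset.sum_congr rfl fun j _ ↦ by ring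
  have hT : ∑ j, (∑ i, Λ1 j i * x i + ∑ j', Λ2 j j' * β j') * (β j - ∑ j', E j j' * β j')
      = (∑ i, ∑ j, x i * β j * Λ1 j i) - (∑ i, ∑ j', x i * β j' * ∑ j, Λ1 j i * E j j')
        + (∑ i, ∑ j, β i * β j * Λ2 j i) - (∑ i, ∑ j', β i * β j' * ∑ j, Λ2 j i * E j j') := by
    rw [hT0, sum_linearForm_mul_eq Λ1 x β, sum_linearForm_mul_linearForm_eq Λ1 E x β,
      sum_linearForm_mul_eq Λ2 β β, sum_linearForm_mul_linearForm_eq Λ2 E β β]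
  -- split the `Sum`-indexed sums into blocks and distribute
  simp only [Fintype.sum_sum_type, Sum.elim_inl, Sum.elim_inr]
  rw [hT]
  simp only [mul_add, mul_sub, Finset.sum_add_distrib, Finset.sum_sub_distrib]
  -- reorder the (β, x) block and symmetrise the (β, β) free-map block
  have hcC : ∑ j : Fin r, ∑ i' : Fin B, β j * x i' * C i' j = ∑ i : Fin B, ∑ j : Fin r, x i * β j * C i j := by
    conv_lhs => rw [Finset.sum_comm]
    exact Finset.sum_congr rfl fun i _ ↦ Finset.sum_congr rfl fun j _ ↦ by ring
  have hcΛ : ∑ j : Fin r, ∑ i' : Fin B, β j * x i' * Λ1 j i' = ∑ i : Fin B, ∑ j : Fin r, x i * β j * Λ1 j i := by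
    conv_lhs => rw [Finset.sum_comm]
    exact Finset.sum_congr rfl fun i _ ↦ Finset.sum_congr rfl fun j _ ↦ by ring
  have hcΛE : ∑ j : Fin r, ∑ i' : Fin B, β j * x i' * (∑ j₀, Λ1 j₀ i' * E j₀ j)
      = ∑ i : Fin B, ∑ j : Fin r, x i * β j * (∑ j₀, Λ1 j₀ i * E j₀ j) := by
    conv_lhs => rw [Finset.sum_comm]
    exact Finset.sum_congr rfl fun i _ ↦ Finset.sum_congr rfl fun j _ ↦ by ring
  have hsΛ : ∑ j : Fin r, ∑ j' : Fin r, β j * β j' * Λ2 j j' = ∑ j : Fin r, ∑ j' : Fin r, β j * β j' * Λ2 j' j := by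
    conv_lhs => rw [Finset.sum_comm]
    exact Finset.sum_congr rfl fun j _ ↦ Finset.sum_congr rfl fun j' _ ↦ by ring
  have hsΛE : ∑ j : Fin r, ∑ j' : Fin r, β j * β j' * (∑ j₀, Λ2 j₀ j' * E j₀ j)
      = ∑ j : Fin r, ∑ j' : Fin r, β j * β j' * (∑ j₀, Λ2 j₀ j * E j₀ j') := by
    conv_lhs => rw [Finset.sum_comm]
    exact Finset.sum_congr rfl fun j _ ↦ Finset.sum_congr rfl fun j' _ ↦ by ring
  rw [hcC, hcΛ, hcΛE, hsΛ, hsΛE]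
  ring

/-! ## From the kernel PSD-check shape to the margin -/

/-- The squared norm of the two blocks as one vector (local copy of `sq_norm_sum_elim`, `WeilFormatCCinfGramData`). -/
private theorem sq_norm_sum_elim_loc {B r : ℕ} (x : Fin B → ℝ) (β : Fin r → ℝ) :
    ∑ k : Fin B ⊕ Fin r, Sum.elim x β k ^ 2 = ∑ i, x i ^ 2 + ∑ j, β j ^ 2 := by
  rw [Fintype.sum_sum_type]
  simp only [Sum.elim_inl, Sum.elim_inr]

/-- **PSD-check shape ⟹ margin.**  If `Σ_p Σ_{p'} α_p α_{p'} (S(e⁻¹p, e⁻¹p') − δ·[p = p']) ≥ 0` for every `α` on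
`Fin (B + r)` (`e = finSumFinEquiv`; the conclusion shape of `PsdDyadic.psd_of_checkPsdMid`), then
`δ Σ_k z_k² ≤ Σ_k Σ_{k'} z_k z_{k'} S(k,k')` for every `z` on `Fin B ⊕ Fin r`. -/
theorem quadForm_margin_of_fin {B r : ℕ} (S : Fin B ⊕ Fin r → Fin B ⊕ Fin r → ℝ) (δ : ℝ)
    (h : ∀ α : Fin (B + r) → ℝ, 0 ≤ ∑ p, ∑ p', α p * α p' *
      (S (finSumFinEquiv.symm p) (finSumFinEquiv.symm p') - if p = p' then δ else 0))
    (z : Fin B ⊕ Fin r → ℝ) :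
    δ * ∑ k, z k ^ 2 ≤ ∑ k, ∑ k', z k * z k' * S k k' := by
  have hs : ∀ g : Fin B ⊕ Fin r → ℝ, ∑ p : Fin (B + r), g (finSumFinEquiv.symm p) = ∑ k, g k :=
    fun g ↦ Equiv.sum_comp finSumFinEquiv.symm g
  have h1 := h (fun p ↦ z (finSumFinEquiv.symm p))
  have e1 : ∑ p : Fin (B + r), ∑ p' : Fin (B + r), z (finSumFinEquiv.symm p) * z (finSumFinEquiv.symm p') *
        (S (finSumFinEquiv.symm p) (finSumFinEquiv.symm p') - if p = p' then δ else 0)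
      = ∑ k, ∑ k', z k * z k' * (S k k' - if k = k' then δ else 0) := by
    rw [← hs (fun k ↦ ∑ k', z k * z k' * (S k k' - if k = k' then δ else 0))]
    refine Finset.sum_congr rfl fun p _ ↦ ?_
    rw [← hs (fun k' ↦ z (finSumFinEquiv.symm p) * z k' *
      (S (finSumFinEquiv.symm p) k' - if finSumFinEquiv.symm p = k' then δ else 0))]
    refine Finset.sum_congr rfl fun p' _ ↦ ?_
    simp only [EmbeddingLike.apply_eq_iff_eq]
  have e2 : ∑ k : Fin B ⊕ Fin r, ∑ k', z k * z k' * (if k = k' then δ else 0) = δ * ∑ k, z k ^ 2 := by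
    rw [Finset.mul_sum]
    refine Finset.sum_congr rfl fun k _ ↦ ?_
    simp only [mul_ite, mul_zero, Finset.sum_ite_eq, Finset.mem_univ, if_true]
    ring
  rw [e1] at h1
  simp only [mul_sub, Finset.sum_sub_distrib] at h1
  rw [e2] at h1
  linarith

/-! ## The sector margins from one quadratic form -/

/-- **Even margin from ONE quadratic form.**  With `Uq(x,β) := Σ_k Σ_{k'} z_k z_{k'} U(k,k')` (`z = (x,β)` on
`Fin (Be+1) ⊕ Fin re`), the margin `δ‖z‖² ≤ zᵀSz` of the explicit resolved-entry matrix `S` (kernel block, resolved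
cross / profile entries, the symmetrised free-map–Parseval correction, minus `U`) gives EXACTLY the `hS` hypothesis of
`hS_even_of_entries` (`WeilFormatCCinfMargins`). -/
theorem hS_even_of_quadForm (a : ℝ) {Be re : ℕ} (se : Finset ℕ) (coefe : Fin re → ℕ → ℝ)
    (Λ1e : Fin re → Fin (Be + 1) → ℝ) (Λ2e : Fin re → Fin re → ℝ)
    (U : Fin (Be + 1) ⊕ Fin re → Fin (Be + 1) ⊕ Fin re → ℝ) {δe : ℝ}
    (hδ : ∀ z : Fin (Be + 1) ⊕ Fin re → ℝ, δe * ∑ k, z k ^ 2 ≤ ∑ k, ∑ k', z k * z k' *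
          (Sum.elim
              (fun i : Fin (Be + 1) ↦ Sum.elim (fun i' : Fin (Be + 1) ↦ (if (i : ℕ) = 0 then gramCoeff a 0 (i' : ℕ) else if (i' : ℕ) = 0 then gramCoeff a (i : ℕ) 0
                      else (gramCoeff a (i : ℕ) (i' : ℕ) + gramCoeff a (i : ℕ) (-(((i' : ℕ)) : ℤ))) / 2))
                (fun j : Fin re ↦ (((weilWindowSesq a ((Icc (-a) a).indicator fun x : ℝ ↦ ∑ q ∈ se, ((coefe j q : ℝ) : ℂ) * ((x : ℂ)) ^ q) (chiEven a (i : ℕ))).re / (if (i : ℕ) = 0 then 1 else Real.sqrt 2))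
                      - ∑ n ∈ Finset.range (Be + 1), (if n = 0 then gramCoeff a 0 (i : ℕ) else if (i : ℕ) = 0 then gramCoeff a n 0
                              else (gramCoeff a n (i : ℕ) + gramCoeff a n (-(((i : ℕ)) : ℤ))) / 2)
                              * ((if n = 0 then 1 else 2) * (Yoshida1992.fourierCoeff a n ((Icc (-a) a).indicator fun x : ℝ ↦ ∑ q ∈ se, ((coefe j q : ℝ) : ℂ) * ((x : ℂ)) ^ q)).re / Real.sqrt (2 * a)))
                  + (Λ1e j i
                        - ∑ j₀, Λ1e j₀ i * (2 * (∫ x, ((Icc (-a) a).indicator fun x : ℝ ↦ ∑ q ∈ se, ((coefe j₀ q : ℝ) : ℂ) * ((x : ℂ)) ^ q) x * conj (((Icc (-a) a).indicator fun x : ℝ ↦ ∑ q ∈ se, ((coefe j q : ℝ) : ℂ) * ((x : ℂ)) ^ q) x)).re - 2 * (((Yoshida1992.fourierCoeff a 0 ((Icc (-a) a).indicator fun x : ℝ ↦ ∑ q ∈ se, ((coefe j₀ q : ℝ) : ℂ) * ((x : ℂ)) ^ q)).re / Real.sqrt (2 * a)) * ((Yoshida1992.fourierCoeff a 0 ((Icc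 (-a) a).indicator fun x : ℝ ↦ ∑ q ∈ se, ((coefe j q : ℝ) : ℂ) * ((x : ℂ)) ^ q)).re / Real.sqrt (2 * a)))
                        - ∑ n ∈ Finset.Ico 1 (Be + 1), (2 * (Yoshida1992.fourierCoeff a n ((Icc (-a) a).indicator fun x : ℝ ↦ ∑ q ∈ se, ((coefe j₀ q : ℝ) : ℂ) * ((x : ℂ)) ^ q)).re / Real.sqrt (2 * a))
                                * (2 * (Yoshida1992.fourierCoeff a n ((Icc (-a) a).indicator fun x : ℝ ↦ ∑ q ∈ se, ((coefe j q : ℝ) : ℂ) * ((x : ℂ)) ^ q)).re / Real.sqrt (2 * a))))) k')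
              (fun j : Fin re ↦ Sum.elim (fun i' : Fin (Be + 1) ↦ (((weilWindowSesq a ((Icc (-a) a).indicator fun x : ℝ ↦ ∑ q ∈ se, ((coefe j q : ℝ) : ℂ) * ((x : ℂ)) ^ q) (chiEven a (i' : ℕ))).re / (if (i' : ℕ) = 0 then 1 else Real.sqrt 2))
                    - ∑ n ∈ Finset.range (Be + 1), (if n = 0 then gramCoeff a 0 (i' : ℕ) else if (i' : ℕ) = 0 then gramCoeff a n 0
                            else (gramCoeff a n (i' : ℕ) + gramCoeff a n (-(((i' : ℕ)) : ℤ))) / 2)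
                            * ((if n = 0 then 1 else 2) * (Yoshida1992.fourierCoeff a n ((Icc (-a) a).indicator fun x : ℝ ↦ ∑ q ∈ se, ((coefe j q : ℝ) : ℂ) * ((x : ℂ)) ^ q)).re / Real.sqrt (2 * a)))
                  + (Λ1e j i'
                        - ∑ j₀, Λ1e j₀ i' * (2 * (∫ x, ((Icc (-a) a).indicator fun x : ℝ ↦ ∑ q ∈ se, ((coefe j₀ q : ℝ) : ℂ) * ((x : ℂ)) ^ q) x * conj (((Icc (-a) a).indicator fun x : ℝ ↦ ∑ q ∈ se, ((coefe j q : ℝ) : ℂ) * ((x : ℂ)) ^ q) x)).re - 2 * (((Yoshida1992.fourierCoeff a 0 ((Icc (-a) a).indicator fun x : ℝ ↦ ∑ q ∈ se, ((coefe j₀ q : ℝ) : ℂ) * ((x : ℂ)) ^ q)).re / Real.sqrt (2 * a)) * ((Yoshida1992.fourierCoeff a 0 ((Icc (-a) a).indicator fun x : ℝ ↦ ∑ q ∈ se, ((coefe j q : ℝ) : ℂ) * ((x : ℂ)) ^ q)).re / Real.sqrt (2 * a)))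
                        - ∑ n ∈ Finset.Ico 1 (Be + 1), (2 * (Yoshida1992.fourierCoeff a n ((Icc (-a) a).indicator fun x : ℝ ↦ ∑ q ∈ se, ((coefe j₀ q : ℝ) : ℂ) * ((x : ℂ)) ^ q)).re / Real.sqrt (2 * a))
                                * (2 * (Yoshida1992.fourierCoeff a n ((Icc (-a) a).indicator fun x : ℝ ↦ ∑ q ∈ se, ((coefe j q : ℝ) : ℂ) * ((x : ℂ)) ^ q)).re / Real.sqrt (2 * a)))))
                (fun j' : Fin re ↦ ((weilWindowSesq a ((Icc (-a) a).indicator fun x : ℝ ↦ ∑ q ∈ se, ((coefe j q : ℝ) : ℂ) * ((x : ℂ)) ^ q) ((Icc (-a) a).indicator fun x : ℝ ↦ ∑ q ∈ se, ((coefe j' q : ℝ) : ℂ) * ((x : ℂ)) ^ q)).re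
                      - ∑ n ∈ Finset.range (Be + 1), ((if n = 0 then 1 else 2) * (Yoshida1992.fourierCoeff a n ((Icc (-a) a).indicator fun x : ℝ ↦ ∑ q ∈ se, ((coefe j' q : ℝ) : ℂ) * ((x : ℂ)) ^ q)).re / Real.sqrt (2 * a))
                              * ((weilWindowSesq a ((Icc (-a) a).indicator fun x : ℝ ↦ ∑ q ∈ se, ((coefe j q : ℝ) : ℂ) * ((x : ℂ)) ^ q) (chiEven a n)).re / (if n = 0 then 1 else Real.sqrt 2))
                      - ∑ n ∈ Finset.range (Be + 1), ((if n = 0 then 1 else 2) * (Yoshida1992.fourierCoeff a n ((Icc (-a) a).indicator fun x : ℝ ↦ ∑ q ∈ se, ((coefe j q : ℝ) : ℂ) * ((x : ℂ)) ^ q)).re / Real.sqrt (2 * a))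
                              * ((weilWindowSesq a ((Icc (-a) a).indicator fun x : ℝ ↦ ∑ q ∈ se, ((coefe j' q : ℝ) : ℂ) * ((x : ℂ)) ^ q) (chiEven a n)).re / (if n = 0 then 1 else Real.sqrt 2))
                      + ∑ n ∈ Finset.range (Be + 1), ((if n = 0 then 1 else 2) * (Yoshida1992.fourierCoeff a n ((Icc (-a) a).indicator fun x : ℝ ↦ ∑ q ∈ se, ((coefe j' q : ℝ) : ℂ) * ((x : ℂ)) ^ q)).re / Real.sqrt (2 * a)) * ∑ n' ∈ Finset.range (Be + 1), (if n' = 0 then gramCoeff a 0 n else if n = 0 then gramCoeff a n' 0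
                              else (gramCoeff a n' n + gramCoeff a n' (-((n) : ℤ))) / 2)
                              * ((if n' = 0 then 1 else 2) * (Yoshida1992.fourierCoeff a n' ((Icc (-a) a).indicator fun x : ℝ ↦ ∑ q ∈ se, ((coefe j q : ℝ) : ℂ) * ((x : ℂ)) ^ q)).re / Real.sqrt (2 * a)))
                  + (Λ2e j' j + Λ2e j j'
                        - ∑ j₀, Λ2e j₀ j * (2 * (∫ x, ((Icc (-a) a).indicator fun x : ℝ ↦ ∑ q ∈ se, ((coefe j₀ q : ℝ) : ℂ) * ((x : ℂ)) ^ q) x * conj (((Icc (-a) a).indicator fun x : ℝ ↦ ∑ q ∈ se, ((coefe j' q : ℝ) : ℂ) * ((x : ℂ)) ^ q) x)).re - 2 * (((Yoshida1992.fourierCoeff a 0 ((Icc (-a) a).indicator fun x : ℝ ↦ ∑ q ∈ se, ((coefe j₀ q : ℝ) : ℂ) * ((x : ℂ)) ^ q)).re / Real.sqrt (2 * a)) * ((Yoshida1992.fourierCoeff a 0 ((Icc (-a) a).indicator fun x : ℝ ↦ ∑ q ∈ se, ((coefe j' q : ℝ) : ℂ) * ((x : ℂ)) ^ q)).re / Real.sqrt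 (2 * a)))
                        - ∑ n ∈ Finset.Ico 1 (Be + 1), (2 * (Yoshida1992.fourierCoeff a n ((Icc (-a) a).indicator fun x : ℝ ↦ ∑ q ∈ se, ((coefe j₀ q : ℝ) : ℂ) * ((x : ℂ)) ^ q)).re / Real.sqrt (2 * a))
                                * (2 * (Yoshida1992.fourierCoeff a n ((Icc (-a) a).indicator fun x : ℝ ↦ ∑ q ∈ se, ((coefe j' q : ℝ) : ℂ) * ((x : ℂ)) ^ q)).re / Real.sqrt (2 * a)))
                        - ∑ j₀, Λ2e j₀ j' * (2 * (∫ x, ((Icc (-a) a).indicator fun x : ℝ ↦ ∑ q ∈ se, ((coefe j₀ q : ℝ) : ℂ) * ((x : ℂ)) ^ q) x * conj (((Icc (-a) a).indicator fun x : ℝ ↦ ∑ q ∈ se, ((coefe j q : ℝ) : ℂ) * ((x : ℂ)) ^ q) x)).re - 2 * (((Yoshida1992.fourierCoeff a 0 ((Icc (-a) a).indicator fun x : ℝ ↦ ∑ q ∈ se, ((coefe j₀ q : ℝ) : ℂ) * ((x : ℂ)) ^ q)).re / Real.sqrt (2 * a)) * ((Yoshida1992.fourierCoeff a 0 ((Icc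 (-a) a).indicator fun x : ℝ ↦ ∑ q ∈ se, ((coefe j q : ℝ) : ℂ) * ((x : ℂ)) ^ q)).re / Real.sqrt (2 * a)))
                        - ∑ n ∈ Finset.Ico 1 (Be + 1), (2 * (Yoshida1992.fourierCoeff a n ((Icc (-a) a).indicator fun x : ℝ ↦ ∑ q ∈ se, ((coefe j₀ q : ℝ) : ℂ) * ((x : ℂ)) ^ q)).re / Real.sqrt (2 * a))
                                * (2 * (Yoshida1992.fourierCoeff a n ((Icc (-a) a).indicator fun x : ℝ ↦ ∑ q ∈ se, ((coefe j q : ℝ) : ℂ) * ((x : ℂ)) ^ q)).re / Real.sqrt (2 * a))))) k')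
              k - U k k'))
    (x : Fin (Be + 1) → ℝ) (β : Fin re → ℝ) :
    δe * (∑ i, x i ^ 2 + ∑ j, β j ^ 2) ≤
        ((∑ i : Fin (Be + 1), ∑ i' : Fin (Be + 1), x i * x i' * (if (i : ℕ) = 0 then gramCoeff a 0 (i' : ℕ) else if (i' : ℕ) = 0 then gramCoeff a (i : ℕ) 0
                else (gramCoeff a (i : ℕ) (i' : ℕ) + gramCoeff a (i : ℕ) (-(((i' : ℕ)) : ℤ))) / 2))
          + 2 * (∑ i : Fin (Be + 1), ∑ j : Fin re, x i * β j * (((weilWindowSesq a ((Icc (-a) a).indicator fun x : ℝ ↦ ∑ q ∈ se, ((coefe j q : ℝ) : ℂ) * ((x : ℂ)) ^ q) (chiEven a (i : ℕ))).re / (if (i : ℕ) = 0 then 1 else Real.sqrt 2))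
                - ∑ n ∈ Finset.range (Be + 1), (if n = 0 then gramCoeff a 0 (i : ℕ) else if (i : ℕ) = 0 then gramCoeff a n 0
                        else (gramCoeff a n (i : ℕ) + gramCoeff a n (-(((i : ℕ)) : ℤ))) / 2)
                        * ((if n = 0 then 1 else 2) * (Yoshida1992.fourierCoeff a n ((Icc (-a) a).indicator fun x : ℝ ↦ ∑ q ∈ se, ((coefe j q : ℝ) : ℂ) * ((x : ℂ)) ^ q)).re / Real.sqrt (2 * a))))
          + (∑ j : Fin re, ∑ j' : Fin re, β j * β j'
                  * ((weilWindowSesq a ((Icc (-a) a).indicator fun x : ℝ ↦ ∑ q ∈ se, ((coefe j q : ℝ) : ℂ) * ((x : ℂ)) ^ q) ((Icc (-a) a).indicator fun x : ℝ ↦ ∑ q ∈ se, ((coefe j' q : ℝ) : ℂ) * ((x : ℂ)) ^ q)).re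
                - ∑ n ∈ Finset.range (Be + 1), ((if n = 0 then 1 else 2) * (Yoshida1992.fourierCoeff a n ((Icc (-a) a).indicator fun x : ℝ ↦ ∑ q ∈ se, ((coefe j' q : ℝ) : ℂ) * ((x : ℂ)) ^ q)).re / Real.sqrt (2 * a))
                        * ((weilWindowSesq a ((Icc (-a) a).indicator fun x : ℝ ↦ ∑ q ∈ se, ((coefe j q : ℝ) : ℂ) * ((x : ℂ)) ^ q) (chiEven a n)).re / (if n = 0 then 1 else Real.sqrt 2))
                - ∑ n ∈ Finset.range (Be + 1), ((if n = 0 then 1 else 2) * (Yoshida1992.fourierCoeff a n ((Icc (-a) a).indicator fun x : ℝ ↦ ∑ q ∈ se, ((coefe j q : ℝ) : ℂ) * ((x : ℂ)) ^ q)).re / Real.sqrt (2 * a))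
                        * ((weilWindowSesq a ((Icc (-a) a).indicator fun x : ℝ ↦ ∑ q ∈ se, ((coefe j' q : ℝ) : ℂ) * ((x : ℂ)) ^ q) (chiEven a n)).re / (if n = 0 then 1 else Real.sqrt 2))
                + ∑ n ∈ Finset.range (Be + 1), ((if n = 0 then 1 else 2) * (Yoshida1992.fourierCoeff a n ((Icc (-a) a).indicator fun x : ℝ ↦ ∑ q ∈ se, ((coefe j' q : ℝ) : ℂ) * ((x : ℂ)) ^ q)).re / Real.sqrt (2 * a)) * ∑ n' ∈ Finset.range (Be + 1), (if n' = 0 then gramCoeff a 0 n else if n = 0 then gramCoeff a n' 0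
                        else (gramCoeff a n' n + gramCoeff a n' (-((n) : ℤ))) / 2)
                        * ((if n' = 0 then 1 else 2) * (Yoshida1992.fourierCoeff a n' ((Icc (-a) a).indicator fun x : ℝ ↦ ∑ q ∈ se, ((coefe j q : ℝ) : ℂ) * ((x : ℂ)) ^ q)).re / Real.sqrt (2 * a)))))
        - (∑ k, ∑ k', Sum.elim x β k * Sum.elim x β k' * U k k')
        + 2 * ∑ j, (∑ i, Λ1e j i * x i + ∑ j', Λ2e j j' * β j') * (β j
              - ∑ j', (2 * (∫ x, ((Icc (-a) a).indicator fun x : ℝ ↦ ∑ q ∈ se, ((coefe j q : ℝ) : ℂ) * ((x : ℂ)) ^ q) x * conj (((Icc (-a) a).indicator fun x : ℝ ↦ ∑ q ∈ se, ((coefe j' q : ℝ) : ℂ) * ((x : ℂ)) ^ q) x)).re - 2 * (((Yoshida1992.fourierCoeff a 0 ((Icc (-a) a).indicator fun x : ℝ ↦ ∑ q ∈ se, ((coefe j q : ℝ) : ℂ) * ((x : ℂ)) ^ q)).re / Real.sqrt (2 * a)) * ((Yoshida1992.fourierCoeff a 0 ((Icc (-a) a).indicator fun x : ℝ ↦ ∑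 q ∈ se, ((coefe j' q : ℝ) : ℂ) * ((x : ℂ)) ^ q)).re / Real.sqrt (2 * a)))
              - ∑ n ∈ Finset.Ico 1 (Be + 1), (2 * (Yoshida1992.fourierCoeff a n ((Icc (-a) a).indicator fun x : ℝ ↦ ∑ q ∈ se, ((coefe j q : ℝ) : ℂ) * ((x : ℂ)) ^ q)).re / Real.sqrt (2 * a))
                      * (2 * (Yoshida1992.fourierCoeff a n ((Icc (-a) a).indicator fun x : ℝ ↦ ∑ q ∈ se, ((coefe j' q : ℝ) : ℂ) * ((x : ℂ)) ^ q)).re / Real.sqrt (2 * a))) * β j') := by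
  have h := margin_eq_quadForm (fun i i' : Fin (Be + 1) ↦ (if (i : ℕ) = 0 then gramCoeff a 0 (i' : ℕ) else if (i' : ℕ) = 0 then gramCoeff a (i : ℕ) 0
          else (gramCoeff a (i : ℕ) (i' : ℕ) + gramCoeff a (i : ℕ) (-(((i' : ℕ)) : ℤ))) / 2))
    (fun (i : Fin (Be + 1)) (j : Fin re) ↦ (((weilWindowSesq a ((Icc (-a) a).indicator fun x : ℝ ↦ ∑ q ∈ se, ((coefe j q : ℝ) : ℂ) * ((x : ℂ)) ^ q) (chiEven a (i : ℕ))).re / (if (i : ℕ) = 0 then 1 else Real.sqrt 2))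
          - ∑ n ∈ Finset.range (Be + 1), (if n = 0 then gramCoeff a 0 (i : ℕ) else if (i : ℕ) = 0 then gramCoeff a n 0
                  else (gramCoeff a n (i : ℕ) + gramCoeff a n (-(((i : ℕ)) : ℤ))) / 2)
                  * ((if n = 0 then 1 else 2) * (Yoshida1992.fourierCoeff a n ((Icc (-a) a).indicator fun x : ℝ ↦ ∑ q ∈ se, ((coefe j q : ℝ) : ℂ) * ((x : ℂ)) ^ q)).re / Real.sqrt (2 * a))))
    (fun j j' : Fin re ↦ ((weilWindowSesq a ((Icc (-a) a).indicator fun x : ℝ ↦ ∑ q ∈ se, ((coefe j q : ℝ) : ℂ) * ((x : ℂ)) ^ q) ((Icc (-a) a).indicator fun x : ℝ ↦ ∑ q ∈ se, ((coefe j' q : ℝ) : ℂ) * ((x : ℂ)) ^ q)).re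
          - ∑ n ∈ Finset.range (Be + 1), ((if n = 0 then 1 else 2) * (Yoshida1992.fourierCoeff a n ((Icc (-a) a).indicator fun x : ℝ ↦ ∑ q ∈ se, ((coefe j' q : ℝ) : ℂ) * ((x : ℂ)) ^ q)).re / Real.sqrt (2 * a))
                  * ((weilWindowSesq a ((Icc (-a) a).indicator fun x : ℝ ↦ ∑ q ∈ se, ((coefe j q : ℝ) : ℂ) * ((x : ℂ)) ^ q) (chiEven a n)).re / (if n = 0 then 1 else Real.sqrt 2))
          - ∑ n ∈ Finset.range (Be + 1), ((if n = 0 then 1 else 2) * (Yoshida1992.fourierCoeff a n ((Icc (-a) a).indicator fun x : ℝ ↦ ∑ q ∈ se, ((coefe j q : ℝ) : ℂ) * ((x : ℂ)) ^ q)).re / Real.sqrt (2 * a))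
                  * ((weilWindowSesq a ((Icc (-a) a).indicator fun x : ℝ ↦ ∑ q ∈ se, ((coefe j' q : ℝ) : ℂ) * ((x : ℂ)) ^ q) (chiEven a n)).re / (if n = 0 then 1 else Real.sqrt 2))
          + ∑ n ∈ Finset.range (Be + 1), ((if n = 0 then 1 else 2) * (Yoshida1992.fourierCoeff a n ((Icc (-a) a).indicator fun x : ℝ ↦ ∑ q ∈ se, ((coefe j' q : ℝ) : ℂ) * ((x : ℂ)) ^ q)).re / Real.sqrt (2 * a)) * ∑ n' ∈ Finset.range (Be + 1), (if n' = 0 then gramCoeff a 0 n else if n = 0 then gramCoeff a n' 0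
                  else (gramCoeff a n' n + gramCoeff a n' (-((n) : ℤ))) / 2)
                  * ((if n' = 0 then 1 else 2) * (Yoshida1992.fourierCoeff a n' ((Icc (-a) a).indicator fun x : ℝ ↦ ∑ q ∈ se, ((coefe j q : ℝ) : ℂ) * ((x : ℂ)) ^ q)).re / Real.sqrt (2 * a))))
    U Λ1e Λ2e (fun j j' : Fin re ↦ (2 * (∫ x, ((Icc (-a) a).indicator fun x : ℝ ↦ ∑ q ∈ se, ((coefe j q : ℝ) : ℂ) * ((x : ℂ)) ^ q) x * conj (((Icc (-a) a).indicator fun x : ℝ ↦ ∑ q ∈ se, ((coefe j' q : ℝ) : ℂ) * ((x : ℂ)) ^ q) x)).re - 2 * (((Yoshida1992.fourierCoeff a 0 ((Icc (-a) a).indicator fun x : ℝ ↦ ∑ q ∈ se, ((coefe j q : ℝ) : ℂ) * ((x : ℂ)) ^ q)).re / Real.sqrt (2 * a)) * ((Yoshida1992.fourierCoeff a 0 ((Icc (-a) a).indicator fun x : ℝ ↦ ∑ q ∈ se, ((coefe j' q : ℝ) : ℂ) * ((x : ℂ)) ^ q)).re / Real.sqrt (2 * a)))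
          - ∑ n ∈ Finset.Ico 1 (Be + 1), (2 * (Yoshida1992.fourierCoeff a n ((Icc (-a) a).indicator fun x : ℝ ↦ ∑ q ∈ se, ((coefe j q : ℝ) : ℂ) * ((x : ℂ)) ^ q)).re / Real.sqrt (2 * a))
                  * (2 * (Yoshida1992.fourierCoeff a n ((Icc (-a) a).indicator fun x : ℝ ↦ ∑ q ∈ se, ((coefe j' q : ℝ) : ℂ) * ((x : ℂ)) ^ q)).re / Real.sqrt (2 * a)))) x β
  beta_reduce at h
  rw [h, ← sq_norm_sum_elim_loc x β]
  exact hδ (Sum.elim x β)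

/-- **Odd margin from ONE quadratic form** (`z = (x,β)` on `Fin Bo ⊕ Fin ro`; odd kernel block `M⁻`, images
`Y_j(i) = Im W(1f_j, w⁻_{i+1})/√2`, tables `V⁻_j(k) = 2 Im ĉ_{k+1}(1f_j)/√(2a)`): the margin of the explicit matrix gives
EXACTLY the `hS` hypothesis of `hS_odd_of_entries`. -/
theorem hS_odd_of_quadForm (a : ℝ) {Bo ro : ℕ} (so : Finset ℕ) (coefo : Fin ro → ℕ → ℝ)
    (Λ1o : Fin ro → Fin Bo → ℝ) (Λ2o : Fin ro → Fin ro → ℝ)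
    (U : Fin Bo ⊕ Fin ro → Fin Bo ⊕ Fin ro → ℝ) {δo : ℝ}
    (hδ : ∀ z : Fin Bo ⊕ Fin ro → ℝ, δo * ∑ k, z k ^ 2 ≤ ∑ k, ∑ k', z k * z k' *
          (Sum.elim
              (fun i : Fin Bo ↦ Sum.elim (fun i' : Fin Bo ↦ ((gramCoeff a (((i : ℕ) : ℤ) + 1) (((i' : ℕ) : ℤ) + 1) - gramCoeff a (((i : ℕ) : ℤ) + 1) (-((((i' : ℕ) : ℤ)) + 1))) / 2))
                (fun j : Fin ro ↦ (((weilWindowSesq a ((Icc (-a) a).indicator fun x : ℝ ↦ ∑ q ∈ so, ((coefo j q : ℝ) : ℂ) * ((x : ℂ)) ^ q) (chiOdd a ((i : ℕ) + 1))).im / Real.sqrt 2)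
                      - ∑ k ∈ Finset.Ico 0 Bo, ((gramCoeff a ((k : ℤ) + 1) (((i : ℕ) : ℤ) + 1) - gramCoeff a ((k : ℤ) + 1) (-(((i : ℕ) : ℤ) + 1))) / 2)
                              * (2 * (Yoshida1992.fourierCoeff a ((k : ℤ) + 1) ((Icc (-a) a).indicator fun x : ℝ ↦ ∑ q ∈ so, ((coefo j q : ℝ) : ℂ) * ((x : ℂ)) ^ q)).im / Real.sqrt (2 * a)))
                  + (Λ1o j i
                        - ∑ j₀, Λ1o j₀ i * (2 * (∫ x, ((Icc (-a) a).indicator fun x : ℝ ↦ ∑ q ∈ so, ((coefo j₀ q : ℝ) : ℂ) * ((x : ℂ)) ^ q) x * conj (((Icc (-a) a).indicator fun x : ℝ ↦ ∑ q ∈ so, ((coefo j q : ℝ) : ℂ) * ((x : ℂ)) ^ q) x)).re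
                        - ∑ k ∈ Finset.range Bo, (2 * (Yoshida1992.fourierCoeff a ((k : ℤ) + 1) ((Icc (-a) a).indicator fun x : ℝ ↦ ∑ q ∈ so, ((coefo j₀ q : ℝ) : ℂ) * ((x : ℂ)) ^ q)).im / Real.sqrt (2 * a))
                                * (2 * (Yoshida1992.fourierCoeff a ((k : ℤ) + 1) ((Icc (-a) a).indicator fun x : ℝ ↦ ∑ q ∈ so, ((coefo j q : ℝ) : ℂ) * ((x : ℂ)) ^ q)).im / Real.sqrt (2 * a))))) k')
              (fun j : Fin ro ↦ Sum.elim (fun i' : Fin Bo ↦ (((weilWindowSesq a ((Icc (-a) a).indicator fun x : ℝ ↦ ∑ q ∈ so, ((coefo j q : ℝ) : ℂ) * ((x : ℂ)) ^ q) (chiOdd a ((i' : ℕ) + 1))).im / Real.sqrt 2)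
                    - ∑ k ∈ Finset.Ico 0 Bo, ((gramCoeff a ((k : ℤ) + 1) (((i' : ℕ) : ℤ) + 1) - gramCoeff a ((k : ℤ) + 1) (-(((i' : ℕ) : ℤ) + 1))) / 2)
                            * (2 * (Yoshida1992.fourierCoeff a ((k : ℤ) + 1) ((Icc (-a) a).indicator fun x : ℝ ↦ ∑ q ∈ so, ((coefo j q : ℝ) : ℂ) * ((x : ℂ)) ^ q)).im / Real.sqrt (2 * a)))
                  + (Λ1o j i'
                        - ∑ j₀, Λ1o j₀ i' * (2 * (∫ x, ((Icc (-a) a).indicator fun x : ℝ ↦ ∑ q ∈ so, ((coefo j₀ q : ℝ) : ℂ) * ((x : ℂ)) ^ q) x * conj (((Icc (-a) a).indicator fun x : ℝ ↦ ∑ q ∈ so, ((coefo j q : ℝ) : ℂ) * ((x : ℂ)) ^ q) x)).re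
                        - ∑ k ∈ Finset.range Bo, (2 * (Yoshida1992.fourierCoeff a ((k : ℤ) + 1) ((Icc (-a) a).indicator fun x : ℝ ↦ ∑ q ∈ so, ((coefo j₀ q : ℝ) : ℂ) * ((x : ℂ)) ^ q)).im / Real.sqrt (2 * a))
                                * (2 * (Yoshida1992.fourierCoeff a ((k : ℤ) + 1) ((Icc (-a) a).indicator fun x : ℝ ↦ ∑ q ∈ so, ((coefo j q : ℝ) : ℂ) * ((x : ℂ)) ^ q)).im / Real.sqrt (2 * a)))))
                (fun j' : Fin ro ↦ ((weilWindowSesq a ((Icc (-a) a).indicator fun x : ℝ ↦ ∑ q ∈ so, ((coefo j q : ℝ) : ℂ) * ((x : ℂ)) ^ q) ((Icc (-a) a).indicator fun x : ℝ ↦ ∑ q ∈ so, ((coefo j' q : ℝ) : ℂ) * ((x : ℂ)) ^ q)).re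
                      - ∑ k ∈ Finset.Ico 0 Bo, (2 * (Yoshida1992.fourierCoeff a ((k : ℤ) + 1) ((Icc (-a) a).indicator fun x : ℝ ↦ ∑ q ∈ so, ((coefo j' q : ℝ) : ℂ) * ((x : ℂ)) ^ q)).im / Real.sqrt (2 * a))
                              * ((weilWindowSesq a ((Icc (-a) a).indicator fun x : ℝ ↦ ∑ q ∈ so, ((coefo j q : ℝ) : ℂ) * ((x : ℂ)) ^ q) (chiOdd a (k + 1))).im / Real.sqrt 2)
                      - ∑ k ∈ Finset.Ico 0 Bo, (2 * (Yoshida1992.fourierCoeff a ((k : ℤ) + 1) ((Icc (-a) a).indicator fun x : ℝ ↦ ∑ q ∈ so, ((coefo j q : ℝ) : ℂ) * ((x : ℂ)) ^ q)).im / Real.sqrt (2 * a))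
                              * ((weilWindowSesq a ((Icc (-a) a).indicator fun x : ℝ ↦ ∑ q ∈ so, ((coefo j' q : ℝ) : ℂ) * ((x : ℂ)) ^ q) (chiOdd a (k + 1))).im / Real.sqrt 2)
                      + ∑ k ∈ Finset.Ico 0 Bo, (2 * (Yoshida1992.fourierCoeff a ((k : ℤ) + 1) ((Icc (-a) a).indicator fun x : ℝ ↦ ∑ q ∈ so, ((coefo j' q : ℝ) : ℂ) * ((x : ℂ)) ^ q)).im / Real.sqrt (2 * a)) * ∑ k' ∈ Finset.Ico 0 Bo, ((gramCoeff a ((k' : ℤ) + 1) ((k : ℤ) + 1) - gramCoeff a ((k' : ℤ) + 1) (-((k : ℤ) + 1))) / 2)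
                              * (2 * (Yoshida1992.fourierCoeff a ((k' : ℤ) + 1) ((Icc (-a) a).indicator fun x : ℝ ↦ ∑ q ∈ so, ((coefo j q : ℝ) : ℂ) * ((x : ℂ)) ^ q)).im / Real.sqrt (2 * a)))
                  + (Λ2o j' j + Λ2o j j'
                        - ∑ j₀, Λ2o j₀ j * (2 * (∫ x, ((Icc (-a) a).indicator fun x : ℝ ↦ ∑ q ∈ so, ((coefo j₀ q : ℝ) : ℂ) * ((x : ℂ)) ^ q) x * conj (((Icc (-a) a).indicator fun x : ℝ ↦ ∑ q ∈ so, ((coefo j' q : ℝ) : ℂ) * ((x : ℂ)) ^ q) x)).re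
                        - ∑ k ∈ Finset.range Bo, (2 * (Yoshida1992.fourierCoeff a ((k : ℤ) + 1) ((Icc (-a) a).indicator fun x : ℝ ↦ ∑ q ∈ so, ((coefo j₀ q : ℝ) : ℂ) * ((x : ℂ)) ^ q)).im / Real.sqrt (2 * a))
                                * (2 * (Yoshida1992.fourierCoeff a ((k : ℤ) + 1) ((Icc (-a) a).indicator fun x : ℝ ↦ ∑ q ∈ so, ((coefo j' q : ℝ) : ℂ) * ((x : ℂ)) ^ q)).im / Real.sqrt (2 * a)))
                        - ∑ j₀, Λ2o j₀ j' * (2 * (∫ x, ((Icc (-a) a).indicator fun x : ℝ ↦ ∑ q ∈ so, ((coefo j₀ q : ℝ) : ℂ) * ((x : ℂ)) ^ q) x * conj (((Icc (-a) a).indicator fun x : ℝ ↦ ∑ q ∈ so, ((coefo j q : ℝ) : ℂ) * ((x : ℂ)) ^ q) x)).re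
                        - ∑ k ∈ Finset.range Bo, (2 * (Yoshida1992.fourierCoeff a ((k : ℤ) + 1) ((Icc (-a) a).indicator fun x : ℝ ↦ ∑ q ∈ so, ((coefo j₀ q : ℝ) : ℂ) * ((x : ℂ)) ^ q)).im / Real.sqrt (2 * a))
                                * (2 * (Yoshida1992.fourierCoeff a ((k : ℤ) + 1) ((Icc (-a) a).indicator fun x : ℝ ↦ ∑ q ∈ so, ((coefo j q : ℝ) : ℂ) * ((x : ℂ)) ^ q)).im / Real.sqrt (2 * a))))) k')
              k - U k k'))
    (x : Fin Bo → ℝ) (β : Fin ro → ℝ) :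
    δo * (∑ i, x i ^ 2 + ∑ j, β j ^ 2) ≤
        ((∑ i : Fin Bo, ∑ i' : Fin Bo, x i * x i' * ((gramCoeff a (((i : ℕ) : ℤ) + 1) (((i' : ℕ) : ℤ) + 1) - gramCoeff a (((i : ℕ) : ℤ) + 1) (-((((i' : ℕ) : ℤ)) + 1))) / 2))
          + 2 * (∑ i : Fin Bo, ∑ j : Fin ro, x i * β j * (((weilWindowSesq a ((Icc (-a) a).indicator fun x : ℝ ↦ ∑ q ∈ so, ((coefo j q : ℝ) : ℂ) * ((x : ℂ)) ^ q) (chiOdd a ((i : ℕ) + 1))).im / Real.sqrt 2)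
                - ∑ k ∈ Finset.Ico 0 Bo, ((gramCoeff a ((k : ℤ) + 1) (((i : ℕ) : ℤ) + 1) - gramCoeff a ((k : ℤ) + 1) (-(((i : ℕ) : ℤ) + 1))) / 2)
                        * (2 * (Yoshida1992.fourierCoeff a ((k : ℤ) + 1) ((Icc (-a) a).indicator fun x : ℝ ↦ ∑ q ∈ so, ((coefo j q : ℝ) : ℂ) * ((x : ℂ)) ^ q)).im / Real.sqrt (2 * a))))
          + (∑ j : Fin ro, ∑ j' : Fin ro, β j * β j'
                  * ((weilWindowSesq a ((Icc (-a) a).indicator fun x : ℝ ↦ ∑ q ∈ so, ((coefo j q : ℝ) : ℂ) * ((x : ℂ)) ^ q) ((Icc (-a) a).indicator fun x : ℝ ↦ ∑ q ∈ so, ((coefo j' q : ℝ) : ℂ) * ((x : ℂ)) ^ q)).re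
                - ∑ k ∈ Finset.Ico 0 Bo, (2 * (Yoshida1992.fourierCoeff a ((k : ℤ) + 1) ((Icc (-a) a).indicator fun x : ℝ ↦ ∑ q ∈ so, ((coefo j' q : ℝ) : ℂ) * ((x : ℂ)) ^ q)).im / Real.sqrt (2 * a))
                        * ((weilWindowSesq a ((Icc (-a) a).indicator fun x : ℝ ↦ ∑ q ∈ so, ((coefo j q : ℝ) : ℂ) * ((x : ℂ)) ^ q) (chiOdd a (k + 1))).im / Real.sqrt 2)
                - ∑ k ∈ Finset.Ico 0 Bo, (2 * (Yoshida1992.fourierCoeff a ((k : ℤ) + 1) ((Icc (-a) a).indicator fun x : ℝ ↦ ∑ q ∈ so, ((coefo j q : ℝ) : ℂ) * ((x : ℂ)) ^ q)).im / Real.sqrt (2 * a))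
                        * ((weilWindowSesq a ((Icc (-a) a).indicator fun x : ℝ ↦ ∑ q ∈ so, ((coefo j' q : ℝ) : ℂ) * ((x : ℂ)) ^ q) (chiOdd a (k + 1))).im / Real.sqrt 2)
                + ∑ k ∈ Finset.Ico 0 Bo, (2 * (Yoshida1992.fourierCoeff a ((k : ℤ) + 1) ((Icc (-a) a).indicator fun x : ℝ ↦ ∑ q ∈ so, ((coefo j' q : ℝ) : ℂ) * ((x : ℂ)) ^ q)).im / Real.sqrt (2 * a)) * ∑ k' ∈ Finset.Ico 0 Bo, ((gramCoeff a ((k' : ℤ) + 1) ((k : ℤ) + 1) - gramCoeff a ((k' : ℤ) + 1) (-((k : ℤ) + 1))) / 2)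
                        * (2 * (Yoshida1992.fourierCoeff a ((k' : ℤ) + 1) ((Icc (-a) a).indicator fun x : ℝ ↦ ∑ q ∈ so, ((coefo j q : ℝ) : ℂ) * ((x : ℂ)) ^ q)).im / Real.sqrt (2 * a)))))
        - (∑ k, ∑ k', Sum.elim x β k * Sum.elim x β k' * U k k')
        + 2 * ∑ j, (∑ i, Λ1o j i * x i + ∑ j', Λ2o j j' * β j') * (β j
              - ∑ j', (2 * (∫ x, ((Icc (-a) a).indicator fun x : ℝ ↦ ∑ q ∈ so, ((coefo j q : ℝ) : ℂ) * ((x : ℂ)) ^ q) x * conj (((Icc (-a) a).indicator fun x : ℝ ↦ ∑ q ∈ so, ((coefo j' q : ℝ) : ℂ) * ((x : ℂ)) ^ q) x)).re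
              - ∑ k ∈ Finset.range Bo, (2 * (Yoshida1992.fourierCoeff a ((k : ℤ) + 1) ((Icc (-a) a).indicator fun x : ℝ ↦ ∑ q ∈ so, ((coefo j q : ℝ) : ℂ) * ((x : ℂ)) ^ q)).im / Real.sqrt (2 * a))
                      * (2 * (Yoshida1992.fourierCoeff a ((k : ℤ) + 1) ((Icc (-a) a).indicator fun x : ℝ ↦ ∑ q ∈ so, ((coefo j' q : ℝ) : ℂ) * ((x : ℂ)) ^ q)).im / Real.sqrt (2 * a))) * β j') := by
  have h := margin_eq_quadForm (fun i i' : Fin Bo ↦ ((gramCoeff a (((i : ℕ) : ℤ) + 1) (((i' : ℕ) : ℤ) + 1) - gramCoeff a (((i : ℕ) : ℤ) + 1) (-((((i' : ℕ) : ℤ)) + 1))) / 2))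
    (fun (i : Fin Bo) (j : Fin ro) ↦ (((weilWindowSesq a ((Icc (-a) a).indicator fun x : ℝ ↦ ∑ q ∈ so, ((coefo j q : ℝ) : ℂ) * ((x : ℂ)) ^ q) (chiOdd a ((i : ℕ) + 1))).im / Real.sqrt 2)
          - ∑ k ∈ Finset.Ico 0 Bo, ((gramCoeff a ((k : ℤ) + 1) (((i : ℕ) : ℤ) + 1) - gramCoeff a ((k : ℤ) + 1) (-(((i : ℕ) : ℤ) + 1))) / 2)
                  * (2 * (Yoshida1992.fourierCoeff a ((k : ℤ) + 1) ((Icc (-a) a).indicator fun x : ℝ ↦ ∑ q ∈ so, ((coefo j q : ℝ) : ℂ) * ((x : ℂ)) ^ q)).im / Real.sqrt (2 * a))))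
    (fun j j' : Fin ro ↦ ((weilWindowSesq a ((Icc (-a) a).indicator fun x : ℝ ↦ ∑ q ∈ so, ((coefo j q : ℝ) : ℂ) * ((x : ℂ)) ^ q) ((Icc (-a) a).indicator fun x : ℝ ↦ ∑ q ∈ so, ((coefo j' q : ℝ) : ℂ) * ((x : ℂ)) ^ q)).re
          - ∑ k ∈ Finset.Ico 0 Bo, (2 * (Yoshida1992.fourierCoeff a ((k : ℤ) + 1) ((Icc (-a) a).indicator fun x : ℝ ↦ ∑ q ∈ so, ((coefo j' q : ℝ) : ℂ) * ((x : ℂ)) ^ q)).im / Real.sqrt (2 * a))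
                  * ((weilWindowSesq a ((Icc (-a) a).indicator fun x : ℝ ↦ ∑ q ∈ so, ((coefo j q : ℝ) : ℂ) * ((x : ℂ)) ^ q) (chiOdd a (k + 1))).im / Real.sqrt 2)
          - ∑ k ∈ Finset.Ico 0 Bo, (2 * (Yoshida1992.fourierCoeff a ((k : ℤ) + 1) ((Icc (-a) a).indicator fun x : ℝ ↦ ∑ q ∈ so, ((coefo j q : ℝ) : ℂ) * ((x : ℂ)) ^ q)).im / Real.sqrt (2 * a))
                  * ((weilWindowSesq a ((Icc (-a) a).indicator fun x : ℝ ↦ ∑ q ∈ so, ((coefo j' q : ℝ) : ℂ) * ((x : ℂ)) ^ q) (chiOdd a (k + 1))).im / Real.sqrt 2)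
          + ∑ k ∈ Finset.Ico 0 Bo, (2 * (Yoshida1992.fourierCoeff a ((k : ℤ) + 1) ((Icc (-a) a).indicator fun x : ℝ ↦ ∑ q ∈ so, ((coefo j' q : ℝ) : ℂ) * ((x : ℂ)) ^ q)).im / Real.sqrt (2 * a)) * ∑ k' ∈ Finset.Ico 0 Bo, ((gramCoeff a ((k' : ℤ) + 1) ((k : ℤ) + 1) - gramCoeff a ((k' : ℤ) + 1) (-((k : ℤ) + 1))) / 2)
                  * (2 * (Yoshida1992.fourierCoeff a ((k' : ℤ) + 1) ((Icc (-a) a).indicator fun x : ℝ ↦ ∑ q ∈ so, ((coefo j q : ℝ) : ℂ) * ((x : ℂ)) ^ q)).im / Real.sqrt (2 * a))))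
    U Λ1o Λ2o (fun j j' : Fin ro ↦ (2 * (∫ x, ((Icc (-a) a).indicator fun x : ℝ ↦ ∑ q ∈ so, ((coefo j q : ℝ) : ℂ) * ((x : ℂ)) ^ q) x * conj (((Icc (-a) a).indicator fun x : ℝ ↦ ∑ q ∈ so, ((coefo j' q : ℝ) : ℂ) * ((x : ℂ)) ^ q) x)).re
          - ∑ k ∈ Finset.range Bo, (2 * (Yoshida1992.fourierCoeff a ((k : ℤ) + 1) ((Icc (-a) a).indicator fun x : ℝ ↦ ∑ q ∈ so, ((coefo j q : ℝ) : ℂ) * ((x : ℂ)) ^ q)).im / Real.sqrt (2 * a))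
                  * (2 * (Yoshida1992.fourierCoeff a ((k : ℤ) + 1) ((Icc (-a) a).indicator fun x : ℝ ↦ ∑ q ∈ so, ((coefo j' q : ℝ) : ℂ) * ((x : ℂ)) ^ q)).im / Real.sqrt (2 * a)))) x β
  beta_reduce at h
  rw [h, ← sq_norm_sum_elim_loc x β]
  exact hδ (Sum.elim x β)

end Summit.RiemannHypothesis.RiemannHypothesis.Theorems.WeilFormatC

end
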